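/-
Origin: expansion seat `planner-pub-hodgecm-toy-g5-0`, handover #4 2026-08-18T15:05:36Z (md5 3b252495) (`HOME/pub-hodgecm-toy-g5/lean/ToyG5/HodgeRiemannGram3.lean`, md5 3b252495, 390 lines);
landed by the gen-8 packager in gate run 31 as `HodgeCM/Model/ToyG2/HodgeRiemannGram3.lean` (import ^import ToyG5\.HodgeRiemannRadical3[ \t]*$→import HodgeCM.Model.ToyG2.HodgeRiemannRadical3 ×1).
-/
-- HANDOVER (planner-pub-hodgecm-toy-g5-0, unit pub-hodgecm-toy-g5): WIP module `ToyG5.HodgeRiemannGram3`; intended final module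
-- `HodgeCM.Model.ToyG2.HodgeRiemannGram3` (kind L5, toy model / consistency witness, EXPANSION part (e), generation 5);
-- rename `import ToyG5.X` ↦ `import HodgeCM.Model.ToyG2.X` (one import: `HodgeRiemannRadical3`, file #3 of this seat).
/-
Copyright (c) 2026. All rights reserved.
Released under Apache 2.0 license as described in the file LICENSE.
-/
import Mathlib
import Summits.HodgeConjecture.HodgeCM.Model.ToyG2.HodgeRiemannRadical3

/-!
# The Gram map of `P_Γ`: HR20 fails in `toyUniverse₃` EXACTLY along the radical of the rational cup pairing

File #4 of generation 5 of the toy lineage (seat `planner-pub-hodgecm-toy-g5-0`).  Files #1–#3 exhibited nonzero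
`(2,0)`-classes `η` of the period surfaces `P_Γ = pms L ι₁ V Γ` of `toyUniverse₃ d t` (`1 ≤ d`, `t² = 16`) with
`tr_ℂ(η ∪ η̄) = 0` and showed that the kernel classes lie in the radical of `(x, z) ↦ tr(x ∪ z)` on `H²(P_Γ) = ⋀² H¹(P_Γ)`.
This file proves the converse: every `HR`-ISOTROPIC `(2,0)`-class lies in that radical, so HR20 fails exactly along it:

* `hr3g_Lam` — **the Gram map** `Lam : H²(P_Γ, ℂ) →ₗ HG`, defined on the wedge basis `Θ₂⁻¹(e_S)` by
  `Λ(e_{S₀}, e_{S₁})`, and `hr3g_Lam_cup : Lam (p ∪ q) = Λ(p, q)` for ALL `p q ∈ H¹(P_Γ, ℂ)` (the Gram map `Λ` of toy-g2's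
  `ThetaGram` is bilinear and alternating, `Λ_self`, `Λ_swap`);
* `hr3g_gram` — **the Hodge–Riemann form on `F²H²(P_Γ)` is a Gram form**: `tr_ℂ(x ∪ conj y) = 4 ⟪Lam y, Lam x⟫` for all
  `x y ∈ F²H²(P_Γ)` (from `hr3_period4_eq_inner` on cup products of `(1,0)`-classes, by sesquilinearity); in particular
  `tr_ℂ(η ∪ η̄) = 4 ⟪Lam η, Lam η⟫` is a nonnegative real (`hr3g_HR_form_nonneg`): the form is positive SEMI-definite on `F²`;
* **`hr3g_radical_of_isotropic` — an `HR`-isotropic `(2,0)`-class is radical**: for `η ∈ F²H²(P_Γ)`,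
  `tr_ℂ(η ∪ η̄) = 0 → ∀ z ∈ H²(P_Γ, ℂ), tr_ℂ(η ∪ z) = 0` (`Lam η = 0`, then `η ⊥_h H^{1,0} ∪ H^{1,0}` by the Gram identity,
  then file #3's weight criterion `hr3_radical_of_orth_H10`);
* `hr3g_HR20_off_radical` — contrapositive: **HR20 holds in `toyUniverse₃` for every `(2,0)`-class which is not in the radical**
  of the rational cup pairing; `hr3g_crossBlock_radical` — the cross-block classes `E_{k₁,0} ∪ E_{k₂,0}` (`k₁ ≠ k₂`) of file #1
  are radical too.

CONSEQUENCE for the lineage (TOY-G5.md §4): the failure of `Fact_hodgeRiemann20` in `toyUniverse₃` is carried entirely by the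
radical `N` of the RATIONAL pairing `tr ∘ ∪` on `⋀² H¹(P_Γ)` (`hr3g_radical_iff_Lam_eq_zero`: on `F²`, radical = `ker Lam`);
informally, the quotient `⋀² H¹ / N` (forced anyway by Poincaré duality) would satisfy HR20 on the image of `F²` — that quotient
model is NOT built here.  Nothing cited, nothing posited, no unfinished proofs.
-/

open scoped TensorProduct InnerProductSpace
open HodgeCM.Toy HodgeCM.Toy.CMPresentation exteriorPower NumberField.ComplexEmbedding
open Literature.AlgebraicGeometry.Motives
open Literature.AlgebraicGeometry.Motives.HodgeStructure (conj conj_smul conj_conj conj_baseChange)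

namespace HodgeCM.ToyG2

open ThetaUiso

noncomputable section

section Main

variable (d t : ℚ) {L : CMField} (ι₁ : L →+* ℂ) {V : HermSpace3 L ι₁} (Γ : Level V)
  (hd : (1 : ℚ) ≤ d) (ht : t ^ 2 = 16)

/-! ### §1 Eigenvector pairs and the degree-one wedge basis -/

/-- `Θ₂⁻¹(e_s ∧ e_{s'}) = e_s ∪ e_{s'}` -/
theorem hr3g_cup_form1 (s s' : (PO ι₁ d t).Idx) :
    ((PO ι₁ d t).Θ 2).symm (ιMulti ℂ 2 ![(PO ι₁ d t).eB s, (PO ι₁ d t).eB s'])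
      = (toyUniverse₃ d t).cup2C ((toyUniverse₃ d t).pms L ι₁ V Γ) 1 ((PO ι₁ d t).form1 ((PO ι₁ d t).eB s)) ((PO ι₁ d t).form1 ((PO ι₁ d t).eB s')) := by
  rw [LinearEquiv.symm_apply_eq]
  exact (theta_pair (PO ι₁ d t) ((PO ι₁ d t).eB s) ((PO ι₁ d t).eB s')).symm

/-- the degree-one wedge basis of `H¹(P_Γ, ℂ)` transported from the eigen-monomials -/
def hr3g_b1 : Module.Basis (Set.powersetCard (PO ι₁ d t).Idx 1) ℂ (V1 ι₁ d t) :=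
  ((PO ι₁ d t).eB.exteriorPower 1).map ((PO ι₁ d t).Θ 1).symm

/-- the degree-one wedge basis vector of a singleton `S` is the eigenvector `e_{S₀}` -/
theorem hr3g_b1_apply (S : Set.powersetCard (PO ι₁ d t).Idx 1) :
    hr3g_b1 d t ι₁ S = (PO ι₁ d t).form1 ((PO ι₁ d t).eB (enum (PO ι₁ d t) S 0)) := by
  rw [hr3g_b1, Module.Basis.map_apply, basis_eq_mono, LinearEquiv.symm_apply_eq, Obj.theta_form1, Obj.mono_def]
  congr 1
  funext j
  fin_cases j
  rfl

/-- the `2`-subset `{s, s'}` of the index set -/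
def hr3g_pair {s s' : (PO ι₁ d t).Idx} (h : s ≠ s') : Set.powersetCard (PO ι₁ d t).Idx 2 :=
  Set.powersetCard.ofCard (Finset.card_pair h)

/-- its sorted enumeration is `(s, s')` or `(s', s)` -/
theorem hr3g_enum_pair {s s' : (PO ι₁ d t).Idx} (h : s ≠ s') :
    (enum (PO ι₁ d t) (hr3g_pair d t ι₁ h) 0 = s ∧ enum (PO ι₁ d t) (hr3g_pair d t ι₁ h) 1 = s') ∨
    (enum (PO ι₁ d t) (hr3g_pair d t ι₁ h) 0 = s' ∧ enum (PO ι₁ d t) (hr3g_pair d t ι₁ h) 1 = s) := by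
  have h0 := enum_mem (PO ι₁ d t) (hr3g_pair d t ι₁ h) 0
  have h1 := enum_mem (PO ι₁ d t) (hr3g_pair d t ι₁ h) 1
  have hne : enum (PO ι₁ d t) (hr3g_pair d t ι₁ h) 0 ≠ enum (PO ι₁ d t) (hr3g_pair d t ι₁ h) 1 :=
    fun e => absurd (enum_injective (PO ι₁ d t) _ e) (by decide)
  simp only [hr3g_pair, Set.powersetCard.val_ofCard, Finset.mem_insert, Finset.mem_singleton] at h0 h1
  rcases h0 with h0 | h0 <;> rcases h1 with h1 | h1
  · exact absurd (h0.trans h1.symm) hne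
  · exact Or.inl ⟨h0, h1⟩
  · exact Or.inr ⟨h0, h1⟩
  · exact absurd (h0.trans h1.symm) hne

/-! ### §2 The Gram map -/

/-- **the Gram map** `Lam : H²(P_Γ, ℂ) →ₗ HG`: `Θ₂⁻¹(e_S) ↦ Λ(e_{S₀}, e_{S₁})` on the wedge basis of eigen-monomials -/
def hr3g_Lam : (toyUniverse₃ d t).CohC ((toyUniverse₃ d t).pms L ι₁ V Γ) 2 →ₗ[ℂ] HG L ι₁ :=
  (((PO ι₁ d t).eB.exteriorPower 2).map ((PO ι₁ d t).Θ 2).symm).constr ℂ fun S =>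
    Λ ι₁ d t hd ht ((PO ι₁ d t).form1 ((PO ι₁ d t).eB (enum (PO ι₁ d t) S 0)))
      ((PO ι₁ d t).form1 ((PO ι₁ d t).eB (enum (PO ι₁ d t) S 1)))

/-- (Ported verbatim from the HodgeCMPerL package; no docstring in the source.) -/
theorem hr3g_Lam_basis (S : Set.powersetCard (PO ι₁ d t).Idx 2) :
    hr3g_Lam d t ι₁ Γ hd ht (((PO ι₁ d t).Θ 2).symm (((PO ι₁ d t).eB.exteriorPower 2) S))
      = Λ ι₁ d t hd ht ((PO ι₁ d t).form1 ((PO ι₁ d t).eB (enum (PO ι₁ d t) S 0)))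
          ((PO ι₁ d t).form1 ((PO ι₁ d t).eB (enum (PO ι₁ d t) S 1))) := by
  have h := Module.Basis.constr_basis (((PO ι₁ d t).eB.exteriorPower 2).map ((PO ι₁ d t).Θ 2).symm) ℂ
    (fun S => Λ ι₁ d t hd ht ((PO ι₁ d t).form1 ((PO ι₁ d t).eB (enum (PO ι₁ d t) S 0)))
      ((PO ι₁ d t).form1 ((PO ι₁ d t).eB (enum (PO ι₁ d t) S 1)))) S
  rw [Module.Basis.map_apply] at h
  exact h

/-- `Lam ∘ Θ₂⁻¹` as one linear map on `⋀²_ℂ H¹` (keeps the sign bookkeeping inside one module) -/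
def hr3g_LamT : ↥(⋀[ℂ]^2 (PO ι₁ d t).LC) →ₗ[ℂ] HG L ι₁ :=
  hr3g_Lam d t ι₁ Γ hd ht ∘ₗ ((PO ι₁ d t).Θ 2).symm.toLinearMap

/-- (Ported verbatim from the HodgeCMPerL package; no docstring in the source.) -/
theorem hr3g_LamT_apply (w : ↥(⋀[ℂ]^2 (PO ι₁ d t).LC)) :
    hr3g_LamT d t ι₁ Γ hd ht w = hr3g_Lam d t ι₁ Γ hd ht (((PO ι₁ d t).Θ 2).symm w) := rfl

/-- (Ported verbatim from the HodgeCMPerL package; no docstring in the source.) -/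
theorem hr3g_LamT_basis (S : Set.powersetCard (PO ι₁ d t).Idx 2) :
    hr3g_LamT d t ι₁ Γ hd ht (((PO ι₁ d t).eB.exteriorPower 2) S)
      = Λ ι₁ d t hd ht ((PO ι₁ d t).form1 ((PO ι₁ d t).eB (enum (PO ι₁ d t) S 0)))
          ((PO ι₁ d t).form1 ((PO ι₁ d t).eB (enum (PO ι₁ d t) S 1))) :=
  hr3g_Lam_basis d t ι₁ Γ hd ht S

/-- `Lam (e_s ∪ e_{s'}) = Λ(e_s, e_{s'})` on pairs of eigenvectors -/
theorem hr3g_Lam_cup_eB (s s' : (PO ι₁ d t).Idx) :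
    hr3g_Lam d t ι₁ Γ hd ht ((toyUniverse₃ d t).cup2C ((toyUniverse₃ d t).pms L ι₁ V Γ) 1
        ((PO ι₁ d t).form1 ((PO ι₁ d t).eB s)) ((PO ι₁ d t).form1 ((PO ι₁ d t).eB s')))
      = Λ ι₁ d t hd ht ((PO ι₁ d t).form1 ((PO ι₁ d t).eB s)) ((PO ι₁ d t).form1 ((PO ι₁ d t).eB s')) := by
  rw [← hr3g_cup_form1]
  by_cases h : s = s'
  · subst h
    have h0 : (((PO ι₁ d t).Θ 2).symm (ιMulti ℂ 2 ![(PO ι₁ d t).eB s, (PO ι₁ d t).eB s]) : (toyUniverse₃ d t).CohC ((toyUniverse₃ d t).pms L ι₁ V Γ) 2) = 0 := by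
      rw [AlternatingMap.map_eq_zero_of_eq (ιMulti ℂ 2) ![(PO ι₁ d t).eB s, (PO ι₁ d t).eB s]
        (i := (0 : Fin 2)) (j := 1) rfl (by decide), map_zero]
    rw [h0, Λ_self]
    exact LinearMap.map_zero _
  · rcases hr3g_enum_pair d t ι₁ h with ⟨h0, h1⟩ | ⟨h0, h1⟩
    · have hb : ιMulti ℂ 2 ![(PO ι₁ d t).eB s, (PO ι₁ d t).eB s']
          = ((PO ι₁ d t).eB.exteriorPower 2) (hr3g_pair d t ι₁ h) := by
        rw [basis_eq_mono, Obj.mono_def]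
        congr 1
        funext j
        fin_cases j
        · exact congrArg (PO ι₁ d t).eB h0.symm
        · exact congrArg (PO ι₁ d t).eB h1.symm
      rw [hb, hr3g_Lam_basis, h0, h1]
    · have hb : ((PO ι₁ d t).eB.exteriorPower 2) (hr3g_pair d t ι₁ h)
          = -ιMulti ℂ 2 ![(PO ι₁ d t).eB s, (PO ι₁ d t).eB s'] := by
        rw [basis_eq_mono, Obj.mono_def, ← AlternatingMap.map_swap (ιMulti ℂ 2) ![(PO ι₁ d t).eB s, (PO ι₁ d t).eB s']
          (show (0 : Fin 2) ≠ 1 by decide)]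
        congr 1
        funext j
        fin_cases j
        · show (PO ι₁ d t).eB (enum (PO ι₁ d t) (hr3g_pair d t ι₁ h) 0) = ![(PO ι₁ d t).eB s, (PO ι₁ d t).eB s'] (Equiv.swap (0 : Fin 2) 1 0)
          rw [Equiv.swap_apply_left, h0]
          rfl
        · show (PO ι₁ d t).eB (enum (PO ι₁ d t) (hr3g_pair d t ι₁ h) 1) = ![(PO ι₁ d t).eB s, (PO ι₁ d t).eB s'] (Equiv.swap (0 : Fin 2) 1 1)
          rw [Equiv.swap_apply_right, h1]
          rfl
      have hn : ιMulti ℂ 2 ![(PO ι₁ d t).eB s, (PO ι₁ d t).eB s'] = -((PO ι₁ d t).eB.exteriorPower 2) (hr3g_pair d t ι₁ h) := by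
        rw [hb, neg_neg]
      rw [← hr3g_LamT_apply, hn]
      simp only [map_neg, hr3g_LamT_basis, h0, h1]
      rw [Λ_swap, neg_neg]

/-- **`Lam (p ∪ q) = Λ(p, q)` for all `p q ∈ H¹(P_Γ, ℂ)`** (both sides are bilinear; checked on the eigenbasis) -/
theorem hr3g_Lam_cup (p q : (toyUniverse₃ d t).CohC ((toyUniverse₃ d t).pms L ι₁ V Γ) 1) :
    hr3g_Lam d t ι₁ Γ hd ht ((toyUniverse₃ d t).cup2C ((toyUniverse₃ d t).pms L ι₁ V Γ) 1 p q)
      = Λ ι₁ d t hd ht p q := by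
  have key : (((toyUniverse₃ d t).cup2C ((toyUniverse₃ d t).pms L ι₁ V Γ) 1).compr₂ (hr3g_Lam d t ι₁ Γ hd ht) :
      (toyUniverse₃ d t).CohC ((toyUniverse₃ d t).pms L ι₁ V Γ) 1 →ₗ[ℂ] (toyUniverse₃ d t).CohC ((toyUniverse₃ d t).pms L ι₁ V Γ) 1 →ₗ[ℂ] HG L ι₁) = Λ ι₁ d t hd ht := by
    refine (hr3g_b1 d t ι₁).ext fun S => (hr3g_b1 d t ι₁).ext fun S' => ?_
    show hr3g_Lam d t ι₁ Γ hd ht ((toyUniverse₃ d t).cup2C ((toyUniverse₃ d t).pms L ι₁ V Γ) 1 (hr3g_b1 d t ι₁ S) (hr3g_b1 d t ι₁ S'))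
      = Λ ι₁ d t hd ht (hr3g_b1 d t ι₁ S) (hr3g_b1 d t ι₁ S')
    rw [hr3g_b1_apply, hr3g_b1_apply]
    exact hr3g_Lam_cup_eB d t ι₁ Γ hd ht _ _
  exact LinearMap.congr_fun (LinearMap.congr_fun key p) q

/-! ### §3 The Gram identity on `F²H²(P_Γ)` -/

/-- the span `D` of the cup products of `(1,0)`-classes (it contains `F²H²(P_Γ)`, `hr3g_mem_D_of_mem_F2`) -/
def hr3g_D : Submodule ℂ ((toyUniverse₃ d t).CohC ((toyUniverse₃ d t).pms L ι₁ V Γ) 2) :=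
  Submodule.span ℂ {w | ∃ a b, a ∈ (toyUniverse₃ d t).H10 ((toyUniverse₃ d t).pms L ι₁ V Γ) ∧
    b ∈ (toyUniverse₃ d t).H10 ((toyUniverse₃ d t).pms L ι₁ V Γ) ∧
    w = (toyUniverse₃ d t).cup2C ((toyUniverse₃ d t).pms L ι₁ V Γ) 1 a b}

/-- `F²H²(P_Γ) ≤ D`: a monomial with two holomorphic indices is a cup product of two `(1,0)`-eigenvectors -/
theorem hr3g_mem_D_of_mem_F2 {η : (toyUniverse₃ d t).CohC ((toyUniverse₃ d t).pms L ι₁ V Γ) 2}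
    (hF : η ∈ ((toyUniverse₃ d t).hodge ((toyUniverse₃ d t).pms L ι₁ V Γ) 2).F 2) :
    η ∈ hr3g_D d t ι₁ Γ := by
  have hx' : η ∈ (exteriorHodgeData.hs (PO ι₁ d t) 2).F 2 := hF
  have hx : (PO ι₁ d t).Θ 2 η ∈ (PO ι₁ d t).FF 2 2 := (PO ι₁ d t).mem_hodgeF.mp hx'
  have key : ∀ w ∈ (PO ι₁ d t).FF 2 2,
      (((PO ι₁ d t).Θ 2).symm w : (toyUniverse₃ d t).CohC ((toyUniverse₃ d t).pms L ι₁ V Γ) 2) ∈ hr3g_D d t ι₁ Γ := by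
    intro w hw
    induction hw using Submodule.span_induction with
    | mem w hw =>
      obtain ⟨g, hg, rfl⟩ := hw
      have h2 : (PO ι₁ d t).cnt g = 2 := le_antisymm ((PO ι₁ d t).cnt_le g) (by exact_mod_cast hg)
      have hu : (PO ι₁ d t).holSlots g = Finset.univ :=
        Finset.eq_univ_of_card _ (by rw [Fintype.card_fin]; exact h2)
      have hh : ∀ j, (PO ι₁ d t).hol (g j) := fun j =>
        ((PO ι₁ d t).mem_holSlots g j).mp (hu ▸ Finset.mem_univ j)
      refine Submodule.subset_span ⟨_, _, hr3r_form1_eB_mem_H10 d t ι₁ Γ (hh 0), hr3r_form1_eB_mem_H10 d t ι₁ Γ (hh 1), ?_⟩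
      rw [Obj.mono_def, show (PO ι₁ d t).eB ∘ g = ![(PO ι₁ d t).eB (g 0), (PO ι₁ d t).eB (g 1)] from by
        funext j; fin_cases j <;> rfl]
      exact hr3g_cup_form1 d t ι₁ Γ (g 0) (g 1)
    | zero => rw [map_zero]; exact Submodule.zero_mem _
    | add a b _ _ ha hb => rw [map_add]; exact Submodule.add_mem _ ha hb
    | smul r a _ ha => rw [map_smul]; exact Submodule.smul_mem _ r ha
  have h := key _ hx
  rwa [LinearEquiv.symm_apply_apply] at h

include hd ht in
/-- the Gram identity on generators: `tr_ℂ((a ∪ b) ∪ conj(c ∪ e)) = 4 ⟪Lam (c ∪ e), Lam (a ∪ b)⟫` for `(1,0)`-classes -/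
theorem hr3g_gram_gen (a b c e : (toyUniverse₃ d t).CohC ((toyUniverse₃ d t).pms L ι₁ V Γ) 1)
    (ha : a ∈ (toyUniverse₃ d t).H10 ((toyUniverse₃ d t).pms L ι₁ V Γ))
    (hb : b ∈ (toyUniverse₃ d t).H10 ((toyUniverse₃ d t).pms L ι₁ V Γ))
    (hc : c ∈ (toyUniverse₃ d t).H10 ((toyUniverse₃ d t).pms L ι₁ V Γ))
    (he : e ∈ (toyUniverse₃ d t).H10 ((toyUniverse₃ d t).pms L ι₁ V Γ)) :
    (toyUniverse₃ d t).trC ((toyUniverse₃ d t).pms L ι₁ V Γ) 4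
        ((toyUniverse₃ d t).cup2C ((toyUniverse₃ d t).pms L ι₁ V Γ) 2
          ((toyUniverse₃ d t).cup2C ((toyUniverse₃ d t).pms L ι₁ V Γ) 1 a b)
          (conj ((toyUniverse₃ d t).cup2C ((toyUniverse₃ d t).pms L ι₁ V Γ) 1 c e)))
      = 4 * ⟪hr3g_Lam d t ι₁ Γ hd ht ((toyUniverse₃ d t).cup2C ((toyUniverse₃ d t).pms L ι₁ V Γ) 1 c e),
              hr3g_Lam d t ι₁ Γ hd ht ((toyUniverse₃ d t).cup2C ((toyUniverse₃ d t).pms L ι₁ V Γ) 1 a b)⟫_ℂ := by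
  rw [hr3g_Lam_cup, hr3g_Lam_cup, ← hr3_period4_eq_inner d t ι₁ Γ hd ht a b c e ha hb hc he]
  have hc' : (conj ((toyUniverse₃ d t).cup2C ((toyUniverse₃ d t).pms L ι₁ V Γ) 1 c e) :
      (toyUniverse₃ d t).CohC ((toyUniverse₃ d t).pms L ι₁ V Γ) 2)
        = (toyUniverse₃ d t).cup2C ((toyUniverse₃ d t).pms L ι₁ V Γ) 1 (conj c) (conj e) :=
    Universe.conj_cup2C ((toyUniverse₃ d t).pms L ι₁ V Γ) 1 c e
  rw [hc']
  rfl

include hd ht in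
/-- the Gram identity, linear extension in the first slot -/
theorem hr3g_gram_left {x : (toyUniverse₃ d t).CohC ((toyUniverse₃ d t).pms L ι₁ V Γ) 2} (hx : x ∈ hr3g_D d t ι₁ Γ)
    (c e : (toyUniverse₃ d t).CohC ((toyUniverse₃ d t).pms L ι₁ V Γ) 1)
    (hc : c ∈ (toyUniverse₃ d t).H10 ((toyUniverse₃ d t).pms L ι₁ V Γ))
    (he : e ∈ (toyUniverse₃ d t).H10 ((toyUniverse₃ d t).pms L ι₁ V Γ)) :
    (toyUniverse₃ d t).trC ((toyUniverse₃ d t).pms L ι₁ V Γ) 4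
        ((toyUniverse₃ d t).cup2C ((toyUniverse₃ d t).pms L ι₁ V Γ) 2 x
          (conj ((toyUniverse₃ d t).cup2C ((toyUniverse₃ d t).pms L ι₁ V Γ) 1 c e)))
      = 4 * ⟪hr3g_Lam d t ι₁ Γ hd ht ((toyUniverse₃ d t).cup2C ((toyUniverse₃ d t).pms L ι₁ V Γ) 1 c e),
              hr3g_Lam d t ι₁ Γ hd ht x⟫_ℂ := by
  induction hx using Submodule.span_induction with
  | mem w hw =>
    obtain ⟨a, b, ha, hb, rfl⟩ := hw
    exact hr3g_gram_gen d t ι₁ Γ hd ht a b c e ha hb hc he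
  | zero => simp only [LinearMap.map_zero, LinearMap.zero_apply, inner_zero_right, mul_zero]
  | add x y _ _ hx hy =>
    rw [LinearMap.map_add₂]
    simp only [LinearMap.map_add]
    rw [hx, hy, inner_add_right, mul_add]
  | smul r x _ hx =>
    rw [LinearMap.map_smul₂]
    simp only [LinearMap.map_smul, smul_eq_mul]
    rw [hx, inner_smul_right]
    ring

include hd ht in
/-- the Gram identity on `D × D` (conjugate-linear extension in the second slot) -/
theorem hr3g_gram_D {x y : (toyUniverse₃ d t).CohC ((toyUniverse₃ d t).pms L ι₁ V Γ) 2}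
    (hx : x ∈ hr3g_D d t ι₁ Γ) (hy : y ∈ hr3g_D d t ι₁ Γ) :
    (toyUniverse₃ d t).trC ((toyUniverse₃ d t).pms L ι₁ V Γ) 4
        ((toyUniverse₃ d t).cup2C ((toyUniverse₃ d t).pms L ι₁ V Γ) 2 x (conj y))
      = 4 * ⟪hr3g_Lam d t ι₁ Γ hd ht y, hr3g_Lam d t ι₁ Γ hd ht x⟫_ℂ := by
  induction hy using Submodule.span_induction with
  | mem w hw =>
    obtain ⟨c, e, hc, he, rfl⟩ := hw
    exact hr3g_gram_left d t ι₁ Γ hd ht hx c e hc he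
  | zero => simp only [LinearMap.map_zero, inner_zero_left, mul_zero]
  | add y y' _ _ hy hy' =>
    simp only [LinearMap.map_add]
    rw [hy, hy', inner_add_left, mul_add]
  | smul r y _ hy =>
    rw [conj_smul]
    simp only [LinearMap.map_smul, smul_eq_mul]
    rw [hy, inner_smul_left]
    ring

include hd ht in
/-- **THE GRAM IDENTITY.** For `x y ∈ F²H²(P_Γ)`: `tr_ℂ(x ∪ conj y) = 4 ⟪Lam y, Lam x⟫` — the Hodge–Riemann form of the
realisation of record on `F²H²(P_Γ)` is the Gram form of the Gram map. -/
theorem hr3g_gram {x y : (toyUniverse₃ d t).CohC ((toyUniverse₃ d t).pms L ι₁ V Γ) 2}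
    (hx : x ∈ ((toyUniverse₃ d t).hodge ((toyUniverse₃ d t).pms L ι₁ V Γ) 2).F 2)
    (hy : y ∈ ((toyUniverse₃ d t).hodge ((toyUniverse₃ d t).pms L ι₁ V Γ) 2).F 2) :
    (toyUniverse₃ d t).trC ((toyUniverse₃ d t).pms L ι₁ V Γ) 4
        ((toyUniverse₃ d t).cup2C ((toyUniverse₃ d t).pms L ι₁ V Γ) 2 x (conj y))
      = 4 * ⟪hr3g_Lam d t ι₁ Γ hd ht y, hr3g_Lam d t ι₁ Γ hd ht x⟫_ℂ :=
  hr3g_gram_D d t ι₁ Γ hd ht (hr3g_mem_D_of_mem_F2 d t ι₁ Γ hx) (hr3g_mem_D_of_mem_F2 d t ι₁ Γ hy)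

include hd ht in
/-- **positive semi-definiteness**: `tr_ℂ(η ∪ η̄) = 4 ⟪Lam η, Lam η⟫` is a nonnegative real for `η ∈ F²H²(P_Γ)` -/
theorem hr3g_HR_form_nonneg {η : (toyUniverse₃ d t).CohC ((toyUniverse₃ d t).pms L ι₁ V Γ) 2}
    (hF : η ∈ ((toyUniverse₃ d t).hodge ((toyUniverse₃ d t).pms L ι₁ V Γ) 2).F 2) :
    0 ≤ ((toyUniverse₃ d t).trC ((toyUniverse₃ d t).pms L ι₁ V Γ) 4 ((toyUniverse₃ d t).cup2C ((toyUniverse₃ d t).pms L ι₁ V Γ) 2 η (conj η))).re ∧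
      ((toyUniverse₃ d t).trC ((toyUniverse₃ d t).pms L ι₁ V Γ) 4 ((toyUniverse₃ d t).cup2C ((toyUniverse₃ d t).pms L ι₁ V Γ) 2 η (conj η))).im = 0 := by
  rw [hr3g_gram d t ι₁ Γ hd ht hF hF]
  have h1 : 0 ≤ RCLike.re ⟪hr3g_Lam d t ι₁ Γ hd ht η, hr3g_Lam d t ι₁ Γ hd ht η⟫_ℂ :=
    inner_self_nonneg (𝕜 := ℂ) (x := hr3g_Lam d t ι₁ Γ hd ht η)
  have h2 : RCLike.im ⟪hr3g_Lam d t ι₁ Γ hd ht η, hr3g_Lam d t ι₁ Γ hd ht η⟫_ℂ = 0 :=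
    inner_self_im (𝕜 := ℂ) (hr3g_Lam d t ι₁ Γ hd ht η)
  simp only [RCLike.re_to_complex, RCLike.im_to_complex] at h1 h2
  refine ⟨?_, ?_⟩
  · simp only [Complex.mul_re, h2, mul_zero, sub_zero]
    exact mul_nonneg (by norm_num) h1
  · simp only [Complex.mul_im, h2, mul_zero, zero_add]
    norm_num

/-! ### §4 HR-isotropic classes are radical -/

include hd ht in
/-- **MAIN THEOREM.** An `HR`-isotropic `(2,0)`-class is in the radical of the rational cup pairing:
for `η ∈ F²H²(P_Γ)` with `tr_ℂ(η ∪ η̄) = 0`, `tr_ℂ(η ∪ z) = 0` for every `z ∈ H²(P_Γ, ℂ)`. -/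
theorem hr3g_radical_of_isotropic {η : (toyUniverse₃ d t).CohC ((toyUniverse₃ d t).pms L ι₁ V Γ) 2}
    (hF : η ∈ ((toyUniverse₃ d t).hodge ((toyUniverse₃ d t).pms L ι₁ V Γ) 2).F 2)
    (h0 : (toyUniverse₃ d t).trC ((toyUniverse₃ d t).pms L ι₁ V Γ) 4
        ((toyUniverse₃ d t).cup2C ((toyUniverse₃ d t).pms L ι₁ V Γ) 2 η (conj η)) = 0)
    (z : (toyUniverse₃ d t).CohC ((toyUniverse₃ d t).pms L ι₁ V Γ) 2) :
    (toyUniverse₃ d t).trC ((toyUniverse₃ d t).pms L ι₁ V Γ) 4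
      ((toyUniverse₃ d t).cup2C ((toyUniverse₃ d t).pms L ι₁ V Γ) 2 η z) = 0 := by
  -- `⟪Lam η, Lam η⟫ = 0`, so `Lam η = 0`
  have hL : hr3g_Lam d t ι₁ Γ hd ht η = 0 := by
    rw [hr3g_gram d t ι₁ Γ hd ht hF hF] at h0
    exact inner_self_eq_zero.mp ((mul_eq_zero.mp h0).resolve_left (by norm_num))
  -- hence `η ⊥_h H^{1,0} ∪ H^{1,0}`, and file #3's weight criterion applies
  refine hr3_radical_of_orth_H10 d t ι₁ Γ hF (fun a b ha hb => ?_) z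
  rw [hr3g_gram d t ι₁ Γ hd ht hF (Universe.cup2C_mem_F2 (toyUniverse₃_modelAxioms_all d t) _ ha hb), hL,
    inner_zero_right, mul_zero]

include hd ht in
/-- **HR20 off the radical.** In `toyUniverse₃ d t` (`1 ≤ d`, `t² = 16`) the Hodge–Riemann relation HOLDS for every
`(2,0)`-class of `P_Γ` which is not in the radical of the rational cup pairing. -/
theorem hr3g_HR20_off_radical {η : (toyUniverse₃ d t).CohC ((toyUniverse₃ d t).pms L ι₁ V Γ) 2}
    (hF : η ∈ ((toyUniverse₃ d t).hodge ((toyUniverse₃ d t).pms L ι₁ V Γ) 2).F 2)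
    (hrad : ∃ z, (toyUniverse₃ d t).trC ((toyUniverse₃ d t).pms L ι₁ V Γ) 4
      ((toyUniverse₃ d t).cup2C ((toyUniverse₃ d t).pms L ι₁ V Γ) 2 η z) ≠ 0) :
    (toyUniverse₃ d t).trC ((toyUniverse₃ d t).pms L ι₁ V Γ) 4
      ((toyUniverse₃ d t).cup2C ((toyUniverse₃ d t).pms L ι₁ V Γ) 2 η (conj η)) ≠ 0 :=
  fun h0 => hrad.elim fun z hz => hz (hr3g_radical_of_isotropic d t ι₁ Γ hd ht hF h0 z)

include hd ht in
/-- the radical restricted to `F²H²(P_Γ)` is exactly the kernel of the Gram map there -/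
theorem hr3g_radical_iff_Lam_eq_zero {η : (toyUniverse₃ d t).CohC ((toyUniverse₃ d t).pms L ι₁ V Γ) 2}
    (hF : η ∈ ((toyUniverse₃ d t).hodge ((toyUniverse₃ d t).pms L ι₁ V Γ) 2).F 2) :
    (∀ z, (toyUniverse₃ d t).trC ((toyUniverse₃ d t).pms L ι₁ V Γ) 4
      ((toyUniverse₃ d t).cup2C ((toyUniverse₃ d t).pms L ι₁ V Γ) 2 η z) = 0)
      ↔ hr3g_Lam d t ι₁ Γ hd ht η = 0 := by
  constructor
  · intro h
    have h0 := h (conj η)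
    rw [hr3g_gram d t ι₁ Γ hd ht hF hF] at h0
    exact inner_self_eq_zero.mp ((mul_eq_zero.mp h0).resolve_left (by norm_num))
  · intro hL
    refine hr3g_radical_of_isotropic d t ι₁ Γ hd ht hF ?_
    rw [hr3g_gram d t ι₁ Γ hd ht hF hF, hL, inner_zero_right, mul_zero]

/-! ### §5 The cross-block classes of file #1 are radical -/

include hd ht in
/-- the cross-block class `E_{k₁,0,ι} ∪ E_{k₂,0,ι}` (`k₁ ≠ k₂`; the HR20-witness of `HodgeRiemann3`) lies in the radical of the
rational cup pairing -/
theorem hr3g_crossBlock_radical {k₁ k₂ : Fin (nQ L ι₁)} (hk : k₁ ≠ k₂)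
    (z : (toyUniverse₃ d t).CohC ((toyUniverse₃ d t).pms L ι₁ V Γ) 2) :
    (toyUniverse₃ d t).trC ((toyUniverse₃ d t).pms L ι₁ V Γ) 4
      ((toyUniverse₃ d t).cup2C ((toyUniverse₃ d t).pms L ι₁ V Γ) 2
        ((toyUniverse₃ d t).cup2C ((toyUniverse₃ d t).pms L ι₁ V Γ) 1
          (eCls ι₁ d t k₁ 0 (embOf L ι₁)) (eCls ι₁ d t k₂ 0 (embOf L ι₁))) z) = 0 := by
  refine hr3g_radical_of_isotropic d t ι₁ Γ hd ht
    (Universe.cup2C_mem_F2 (toyUniverse₃_modelAxioms_all d t) _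
      (hr3k_eCls_mem_H10 d t ι₁ Γ k₁ 0) (hr3k_eCls_mem_H10 d t ι₁ Γ k₂ 0)) ?_ z
  -- `tr_ℂ(η ∪ η̄) = period(E₁, E₂, E₁, E₂) = 0`: a family meeting two distinct blocks
  have h := period_eCls_mixed₃ d t ι₁ Γ ![k₁, k₂, k₁, k₂] (fun _ => (0 : Fin 4)) (fun _ => embOf L ι₁)
    (a := 0) (b := 1) (by simpa using hk)
  have hp : (toyUniverse₃ d t).trC ((toyUniverse₃ d t).pms L ι₁ V Γ) 4
      ((toyUniverse₃ d t).cup2C ((toyUniverse₃ d t).pms L ι₁ V Γ) 2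
        ((toyUniverse₃ d t).cup2C ((toyUniverse₃ d t).pms L ι₁ V Γ) 1 (eCls ι₁ d t k₁ 0 (embOf L ι₁)) (eCls ι₁ d t k₂ 0 (embOf L ι₁)))
        ((toyUniverse₃ d t).cup2C ((toyUniverse₃ d t).pms L ι₁ V Γ) 1 (conj (eCls ι₁ d t k₁ 0 (embOf L ι₁)))
          (conj (eCls ι₁ d t k₂ 0 (embOf L ι₁))))) = 0 := h
  rw [← Universe.conj_cup2C] at hp
  exact hp

end Main

end

end HodgeCM.ToyG2
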